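import Literature.NumberTheory.EllipticCurves.ModularFunctionField
import Literature.NumberTheory.EllipticCurves.ModularFormsRamanujan
import Literature.NumberTheory.EllipticCurves.ModularCurveEllipticPointsProofs
import Literature.NumberTheory.DiophantineGeometry.FunctionFieldDivisorsResidueMap
import Mathlib.RingTheory.Valuation.Discrete.Basic
import HarnessLib

/-!
# Places of the modular function field `K_N` at the points of `Y₀(N)` (trunk EllArithM; layer 4
  of the Riemann–Roch bridge to `dim S₂(Γ₀(N)) = g(X₀(N))`)

For the algebraic function field `K_N/ℂ` of `ModularFunctionField` (the `q`-expansions of ratios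
of modular forms of equal weight for `Γ₀(N)`), this file constructs the place `P_τ` attached to a
point `τ ∈ ℍ` (depending only on `Γ₀(N)τ ∈ Y₀(N)`), in the format
`Literature.AlgFunctionField.PlaceOver ℂ K_N` of the tree's Riemann–Roch development
(`DiophantineGeometry/FunctionFieldDivisors`), and computes its valuation in terms of orders of
vanishing of modular forms (Shimura 1971, §2.4; Diamond–Shurman §3.2, §7.5):

* `orderAt F τ ∈ ℕ`: the order of vanishing of a modular form `F ≠ 0` for `Γ₀(N)` at `τ`
  (Mathlib `analyticOrderAt`, finite by the identity theorem; additive on products).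
* `deriv_pow_eq_of_comp_eq_mul`, `deriv_smul_pow_orderAt_eq` — the **multiplier identity**
  `γ'(τ)^{ord_τ F} = (cτ+d)^k` for `γ ∈ Γ₀(N)` fixing `τ` — and
  `ellipticPeriod_dvd_orderAt_sub`: **`e_τ ∣ ord_τ(F) − ord_τ(G)`** for nonzero forms of the same
  weight, `e_τ = h_τ(Γ₀(N)) ∈ {1, 2, 3}` the period (`γ'(τ) = −1` resp. `ρ²` for the generators
  `kSk⁻¹`, `k(ST)k⁻¹` of the isotropy groups at `k·i`, `k·ρ`).
* `ordAt τ x = ord_τ F − ord_τ G ∈ ℤ` for `x = F/G ∈ K_N` (well defined by the `q`-expansion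
  principle, `ordAt_eq_of_repr`), multiplicative, ultrametric, `e_τ ∣ ordAt`; the normalised order
  `ordAtN τ x = ordAt τ x / e_τ` (Diamond–Shurman §3.2: the order on `X₀(N)` at an elliptic point).
* `pointValuation τ : Valuation K_N ℤᵐ⁰`, `v_τ(x) = exp(−ordAtN τ x)`, with nontrivial value group
  (`v_τ(j − j(τ)) < 1`), and **the place** `pointPlace τ : PlaceOver ℂ K_N` (valuation ring
  `{ordAt ≥ 0}`, a DVR by Mathlib `Valuation.valuationSubring_isDiscreteValuationRing`);
  `pointPlace_smul_of_mem`: `P_{γτ} = P_τ` for `γ ∈ Γ₀(N)`.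
* Uniformizers: `kleinJSub N τ = j − j(τ)` has `ordAt = 3, 2, 1` (`E₄(τ) = 0`, `E₆(τ) = 0`, else;
  from `ModularFormsRamanujan`), hence is a uniformizer whenever this ramification index equals
  `e_τ` (`pointValuation_kleinJSub_of_eq`; i.e. at elliptic points and at points with
  `E₄E₆(τ) ≠ 0`), and then `pointPlace_valuation_le_iff_of_eq` reads the Riemann–Roch condition
  `v_P(x) ≤ v_P(π_P)^{−n}` as `−n ≤ ordAtN τ x`. (The remaining points — non-elliptic points in the
  orbits of `i`, `ρ` — need the level-raising operator `f ↦ f(Nτ)` and are treated in the sequel.)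

Everything is in `namespace Literature.ModularForms`; all statements are proved.

## References

* G. Shimura, *Introduction to the arithmetic theory of automorphic functions*, Princeton 1971,
  §1.5, §2.4.
* F. Diamond, J. Shurman, *A first course in modular forms*, GTM 228, Springer 2005, §2.3, §3.2, §7.5.
* H. Stichtenoth, *Algebraic Function Fields and Codes*, 2nd ed., GTM 254, Springer 2009, §1.1.
-/

noncomputable section

open UpperHalfPlane hiding I
open ModularForm SlashInvariantForm ModularFormClass Filter Function CongruenceSubgroup
  EisensteinSeries Polynomial ModularGroup
open scoped MatrixGroups Real Topology Manifold IntermediateField WithZero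

namespace Literature.NumberTheory.EllipticCurves.ModularForms


/-! ### Orders of vanishing of modular forms at points of `ℍ` -/

section OrderAt

variable {N : ℕ}

/-- A nonzero modular form for `Γ₀(N)` has finite order of vanishing at every point of `ℍ`
(identity theorem on the connected open set `ℍ`). [folklore] -/
theorem analyticOrderAt_ne_top {k : ℤ} {F : ModularForm (Gamma0 N) k} (hF : F ≠ 0) (τ : ℍ) :
    analyticOrderAt ((F : ℍ → ℂ) ∘ ofComplex) τ ≠ ⊤ := by
  intro h
  rw [analyticOrderAt_eq_top] at h
  apply hF
  apply DFunLike.ext' 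
  refine UpperHalfPlane.eq_zero_of_frequently (holo F) (τ := τ) ?_
  have h' : ∀ᶠ z in 𝓝 (τ : ℂ), ((F : ℍ → ℂ) ∘ ofComplex) z = 0 := h
  have h'' : ∀ᶠ w in 𝓝 τ, F w = 0 := by
    have := (UpperHalfPlane.continuous_coe.tendsto τ).eventually h'
    filter_upwards [this] with w hw
    simpa [Function.comp_apply, ofComplex_apply] using hw
  exact (h''.filter_mono nhdsWithin_le_nhds).frequently

/-- The **order of vanishing** `ord_τ(F) ∈ ℕ` of a modular form `F` for `Γ₀(N)` at `τ ∈ ℍ`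
(Diamond–Shurman §3.2; junk `0` for `F = 0`). [folklore] -/
def orderAt {k : ℤ} (F : ModularForm (Gamma0 N) k) (τ : ℍ) : ℕ :=
  (analyticOrderAt ((F : ℍ → ℂ) ∘ ofComplex) τ).toNat

/-- `ord_τ(F)` as an element of `ℕ∞` is the analytic order, for `F ≠ 0`. [folklore] -/
theorem orderAt_eq {k : ℤ} {F : ModularForm (Gamma0 N) k} (hF : F ≠ 0) (τ : ℍ) :
    (orderAt F τ : ℕ∞) = analyticOrderAt ((F : ℍ → ℂ) ∘ ofComplex) τ := by
  rw [orderAt, ENat.coe_toNat (analyticOrderAt_ne_top hF τ)]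

/-- **`ord_τ(FG) = ord_τ(F) + ord_τ(G)`** for nonzero forms. [folklore] -/
theorem orderAt_mul {a b : ℤ} {F : ModularForm (Gamma0 N) a} {G : ModularForm (Gamma0 N) b}
    (hF : F ≠ 0) (hG : G ≠ 0) (τ : ℍ) : orderAt (F.mul G) τ = orderAt F τ + orderAt G τ := by
  have hFG : F.mul G ≠ 0 := by
    rw [Ne, ← qExpansionL_eq_zero_iff, qExpansionL_mul, mul_eq_zero, qExpansionL_eq_zero_iff,
      qExpansionL_eq_zero_iff, not_or]
    exact ⟨hF, hG⟩
  have h := orderAt_eq hFG τ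
  rw [ModularForm.coe_mul, show ((⇑F * ⇑G) ∘ ofComplex) = ((F : ℍ → ℂ) ∘ ofComplex) * ((G : ℍ → ℂ) ∘ ofComplex)
    from rfl, analyticOrderAt_mul (analyticAt_comp_ofComplex (holo F) τ) (analyticAt_comp_ofComplex (holo G) τ),
    ← orderAt_eq hF, ← orderAt_eq hG] at h
  exact_mod_cast h

/-- `ord_τ` ignores weight casts. [folklore] -/
@[simp] theorem orderAt_mcast {a b : ℤ} (h : a = b) (F : ModularForm (Gamma0 N) a) (τ : ℍ) :
    orderAt (F.mcast h) τ = orderAt F τ := rfl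

/-- `ord_τ(f|_{Γ₀(N)}) = ord_τ(f)` for a level-one form viewed at level `Γ₀(N)`. [folklore] -/
theorem orderAt_ofLevelOne {k : ℤ} (f : ModularForm 𝒮ℒ k) (τ : ℍ) :
    orderAt (ofLevelOne (Gamma0 N) f) τ = (analyticOrderAt ((f : ℍ → ℂ) ∘ ofComplex) τ).toNat := rfl

/-- `ord_τ(Δ) = 0`. [folklore] -/
theorem orderAt_delta (τ : ℍ) : orderAt (ofLevelOne (Gamma0 N) delta) τ = 0 := by
  rw [orderAt_ofLevelOne]
  change (analyticOrderAt (ModularForm.discriminant ∘ ofComplex) τ).toNat = 0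
  rw [analyticOrderAt_discriminant]; rfl

/-- The weight-`12` level-one form `E₄³ − c Δ`, at level `Γ₀(N)`. [folklore] -/
def E₄cubeSubSmulDelta (N : ℕ) (c : ℂ) : ModularForm (Gamma0 N) 12 :=
  ofLevelOne (Gamma0 N) (E₄cube - c • delta)

/-- Pointwise formula for `E₄cubeSubSmulDelta`. [folklore] -/
@[simp] theorem E₄cubeSubSmulDelta_apply (c : ℂ) (τ : ℍ) :
    E₄cubeSubSmulDelta N c τ = E₄ τ ^ 3 - c * ModularForm.discriminant τ := by
  rw [show (E₄cubeSubSmulDelta N c : ℍ → ℂ) = ⇑((E₄cube : ModularForm 𝒮ℒ 12) - c • delta) from rfl,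
    ModularForm.coe_sub, IsGLPos.coe_smul]
  simp

/-- `ord_τ(0) = 0` (junk value). [folklore] -/
theorem orderAt_zero {k : ℤ} (τ : ℍ) : orderAt (0 : ModularForm (Gamma0 N) k) τ = 0 := by
  rw [orderAt, ModularForm.coe_zero]
  have : analyticOrderAt ((0 : ℍ → ℂ) ∘ ofComplex) (τ : ℂ) = ⊤ :=
    analyticOrderAt_eq_top.mpr (Eventually.of_forall fun _ ↦ rfl)
  rw [this]; rfl

/-- **`ord_{τ₀}(E₄³ − j(τ₀)Δ) = 3, 2, 1`** according as `E₄(τ₀) = 0`, `E₆(τ₀) = 0` or neither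
(the ramification index of `j` at `τ₀`; from `ModularFormsRamanujan`). [folklore] -/
theorem orderAt_E₄cubeSubSmulDelta_kleinJ (τ₀ : ℍ) :
    orderAt (E₄cubeSubSmulDelta N (kleinJ τ₀)) τ₀ = if E₄ τ₀ = 0 then 3 else if E₆ τ₀ = 0 then 2 else 1 := by
  rw [orderAt]
  have : ((E₄cubeSubSmulDelta N (kleinJ τ₀) : ℍ → ℂ) ∘ ofComplex) =
      ((fun τ : ℍ ↦ E₄ τ ^ 3 - kleinJ τ₀ * ModularForm.discriminant τ) ∘ ofComplex) := by
    funext z; simp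
  rw [this, analyticOrderAt_E₄_cube_sub_kleinJ_mul_discriminant]
  split_ifs <;> rfl

/-- `E₄³ − j(τ₀)Δ ≠ 0` (it vanishes to finite order at `τ₀`). [folklore] -/
theorem E₄cubeSubSmulDelta_ne_zero (τ₀ : ℍ) : E₄cubeSubSmulDelta N (kleinJ τ₀) ≠ 0 := by
  intro h
  have := orderAt_E₄cubeSubSmulDelta_kleinJ (N := N) τ₀
  rw [h, orderAt_zero] at this
  split_ifs at this

/-- `Δ|_{Γ₀(N)} ≠ 0`. [folklore] -/
theorem ofLevelOne_delta_ne_zero : ofLevelOne (Gamma0 N) delta ≠ 0 := fun h0 ↦ by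
  have := congrArg (fun f : ModularForm (Gamma0 N) 12 ↦ f UpperHalfPlane.I) h0
  simp only [coe_ofLevelOne, delta_apply, ModularForm.zero_apply] at this
  exact ModularForm.discriminant_ne_zero _ this

end OrderAt

/-! ### Leading coefficients and the isotropy group: `e_τ ∣ ord_τ(F) − ord_τ(G)` -/

section Isotropy

variable {N : ℕ}

/-- **Leading coefficients under a map fixing the point.** Let `A` be analytic at `z₀` of finite
order `n` with `A = (z − z₀)ⁿ H`, `H(z₀) ≠ 0`, let `g` be analytic with `g(z₀) = z₀`, and suppose
`A ∘ g = u · A` near `z₀` with `u` continuous at `z₀`. Then `g'(z₀)ⁿ = u(z₀)` (compare leading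
coefficients: `(g(z) − z₀)/(z − z₀) → g'(z₀)`). [folklore] -/
theorem deriv_pow_eq_of_comp_eq_mul {A g u : ℂ → ℂ} {z₀ : ℂ} {n : ℕ} (hA : AnalyticAt ℂ A z₀)
    (hn : analyticOrderAt A z₀ = n) (hg : AnalyticAt ℂ g z₀) (hg0 : g z₀ = z₀)
    (hu : ContinuousAt u z₀) (heq : (A ∘ g) =ᶠ[𝓝 z₀] fun z ↦ u z * A z) :
    deriv g z₀ ^ n = u z₀ := by
  obtain ⟨H, hHa, hH0, hAH⟩ := (hA.analyticOrderAt_eq_natCast).mp hn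
  -- on a punctured neighbourhood: `((g z - z₀)/(z - z₀))^n * H (g z) = u z * H z`
  have hgcont : ContinuousAt g z₀ := hg.continuousAt
  have hAHg : ∀ᶠ z in 𝓝 z₀, A (g z) = (g z - z₀) ^ n • H (g z) := by
    have := hgcont.tendsto
    rw [hg0] at this
    exact this.eventually hAH
  have key : ∀ᶠ z in 𝓝[≠] z₀, ((g z - z₀) / (z - z₀)) ^ n * H (g z) = u z * H z := by
    have h1 : ∀ᶠ z in 𝓝[≠] z₀, z ≠ z₀ := self_mem_nhdsWithin
    filter_upwards [h1, nhdsWithin_le_nhds hAHg, nhdsWithin_le_nhds hAH, nhdsWithin_le_nhds heq]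
      with z hz h2 h3 h4
    have hz' : (z - z₀) ^ n ≠ 0 := pow_ne_zero _ (sub_ne_zero.mpr hz)
    simp only [Function.comp_apply, smul_eq_mul] at h2 h3 h4
    rw [h2, h3] at h4
    -- `h4 : (g z - z₀)^n * H (g z) = u z * ((z - z₀)^n * H z)`
    rw [div_pow, div_mul_eq_mul_div, div_eq_iff hz']
    linear_combination h4
  -- limits of both sides along `𝓝[≠] z₀`
  have hslope : Tendsto (fun z ↦ (g z - z₀) / (z - z₀)) (𝓝[≠] z₀) (𝓝 (deriv g z₀)) := by
    have hd : HasDerivAt g (deriv g z₀) z₀ := hg.differentiableAt.hasDerivAt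
    have := hd.tendsto_slope
    simp only [slope_fun_def_field, hg0] at this
    exact this
  have hL : Tendsto (fun z ↦ ((g z - z₀) / (z - z₀)) ^ n * H (g z)) (𝓝[≠] z₀)
      (𝓝 (deriv g z₀ ^ n * H z₀)) := by
    refine (hslope.pow n).mul ?_
    have hg' : Tendsto g (𝓝 z₀) (𝓝 z₀) := by
      have h := hgcont.tendsto
      rwa [hg0] at h
    exact (hHa.continuousAt.tendsto.comp hg').mono_left nhdsWithin_le_nhds
  have hR : Tendsto (fun z ↦ u z * H z) (𝓝[≠] z₀) (𝓝 (u z₀ * H z₀)) :=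
    ((hu.tendsto.mul hHa.continuousAt.tendsto).mono_left nhdsWithin_le_nhds)
  have := tendsto_nhds_unique (hL.congr' key) hR
  exact mul_right_cancel₀ hH0 this

/-- **The multiplier identity.** For `γ ∈ SL₂(ℤ)` fixing `τ` and a holomorphic `f` of weight `k`
for `γ` (`f|_kγ = f`) of finite order `n` at `τ`: `γ'(τ)ⁿ = (cτ + d)^k`, `γ'(τ) = (cτ+d)^{-2}`
(Diamond–Shurman §2.3–3.2: the local behaviour at elliptic points). [folklore] -/
theorem deriv_smul_pow_orderAt_eq {k : ℤ} {f : ℍ → ℂ} (hf : MDiff f) {γ : SL(2, ℤ)}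
    (hγf : f ∣[k] γ = f) {τ : ℍ} (hγτ : γ • τ = τ) {n : ℕ}
    (hn : analyticOrderAt (f ∘ ofComplex) τ = n) :
    (denom γ τ ^ 2)⁻¹ ^ n = denom γ τ ^ k := by
  have hdet1 : ((γ : GL (Fin 2) ℝ)).val.det = 1 := by
    rw [← Matrix.GeneralLinearGroup.val_det_apply]; simp
  have hdet : 0 < ((γ : GL (Fin 2) ℝ)).val.det := by rw [hdet1]; exact one_pos
  set g : ℂ → ℂ := fun z ↦ ((((γ : GL (Fin 2) ℝ)) • ofComplex z : ℍ) : ℂ) with hg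
  have hga : AnalyticAt ℂ g τ := analyticAt_smul_ofComplex hdet τ
  have hgτ : g τ = τ := by
    show ((((γ : GL (Fin 2) ℝ)) • ofComplex (τ : ℂ) : ℍ) : ℂ) = τ
    rw [ofComplex_apply]
    exact congrArg UpperHalfPlane.coe hγτ
  have hdg : deriv g τ = (denom γ τ ^ 2)⁻¹ := by
    rw [hg, UpperHalfPlane.deriv_smul hdet, hdet1, Complex.ofReal_one, one_div]
  set u : ℂ → ℂ := fun z ↦ denom (γ : GL (Fin 2) ℝ) z ^ k with hu
  have huc : ContinuousAt u τ := by
    refine ContinuousAt.zpow₀ (by fun_prop) _ (Or.inl (denom_ne_zero _ τ))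
  have heq : ((f ∘ ofComplex) ∘ g) =ᶠ[𝓝 (τ : ℂ)] fun z ↦ u z * (f ∘ ofComplex) z := by
    filter_upwards [isOpen_upperHalfPlaneSet.mem_nhds τ.im_pos] with z hz
    have h1 := congrFun hγf ⟨z, hz⟩
    rw [ModularForm.SL_slash_apply] at h1
    simp only [Function.comp_apply, hg, hu, ofComplex_apply_of_im_pos hz, ofComplex_apply]
    -- `h1 : f (γ • ⟨z, hz⟩) * denom γ z ^ (-k) = f ⟨z, hz⟩`
    have hd : denom (γ : GL (Fin 2) ℝ) z ≠ 0 := denom_ne_zero_of_im _ (ne_of_gt hz)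
    rw [← h1]
    show f (((γ : GL (Fin 2) ℝ)) • (⟨z, hz⟩ : ℍ)) =
      denom (γ : GL (Fin 2) ℝ) z ^ k * (f (γ • (⟨z, hz⟩ : ℍ)) * denom (γ : GL (Fin 2) ℝ) z ^ (-k))
    rw [mul_left_comm, ← zpow_add₀ hd, add_neg_cancel, zpow_zero, mul_one]
    rfl
  have := deriv_pow_eq_of_comp_eq_mul (analyticAt_comp_ofComplex hf τ) hn hga hgτ huc heq
  rwa [hdg] at this

end Isotropy


section Isotropy2

variable {N : ℕ}

/-- `denom` of a product of elements of `SL₂(ℤ)` (cocycle). [folklore] -/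
theorem denom_mul_sl (a b : SL(2, ℤ)) (z : ℍ) :
    denom (↑(a * b) : GL (Fin 2) ℝ) z = denom (a : GL (Fin 2) ℝ) ↑(b • z) * denom (b : GL (Fin 2) ℝ) z := by
  have hb : 0 < ((b : GL (Fin 2) ℝ)).det.val := by simp
  rw [show ((a * b : SL(2, ℤ)) : GL (Fin 2) ℝ) = (a : GL (Fin 2) ℝ) * (b : GL (Fin 2) ℝ) from
      map_mul (Matrix.SpecialLinearGroup.mapGL ℝ) a b,
    denom_cocycle _ _ z.im_ne_zero, ← coe_smul_of_det_pos hb, sl_moeb]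

/-- For `γ₀ = kSk⁻¹` and `τ = k·i`: `γ₀` fixes `τ` and `denom γ₀ τ = i` (so `γ₀'(τ) = −1`).
[folklore] -/
theorem conj_S_smul_and_denom (k : SL(2, ℤ)) :
    (k * S * k⁻¹) • (k • UpperHalfPlane.I) = k • UpperHalfPlane.I ∧
      denom (↑(k * S * k⁻¹) : GL (Fin 2) ℝ) ↑(k • UpperHalfPlane.I) = Complex.I := by
  have hS : S • UpperHalfPlane.I = UpperHalfPlane.I := stabilizer_I.mpr (by simp)
  refine ⟨by rw [mul_smul, mul_smul, inv_smul_smul, hS], ?_⟩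
  rw [denom_mul_sl, denom_mul_sl, inv_smul_smul, hS, denom_S]
  have h1 : denom (↑(k⁻¹ * k) : GL (Fin 2) ℝ) UpperHalfPlane.I = 1 := by
    rw [inv_mul_cancel]; simp [denom]
  rw [denom_mul_sl] at h1
  rw [show ∀ a b c : ℂ, a * b * c = b * (c * a) from fun a b c ↦ by ring, h1, mul_one]
  rfl

/-- For `γ₀ = k(ST)k⁻¹` and `τ = k·ρ`: `γ₀` fixes `τ` and `denom γ₀ τ = ρ + 1` (so
`γ₀'(τ) = (ρ+1)⁻² = ρ²`). [folklore] -/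
theorem conj_ST_smul_and_denom (k : SL(2, ℤ)) :
    (k * (S * T) * k⁻¹) • (k • ρ) = k • ρ ∧
      denom (↑(k * (S * T) * k⁻¹) : GL (Fin 2) ℝ) ↑(k • ρ) = (ρ : ℂ) + 1 := by
  have hST : (S * T) • ρ = ρ := stabilizer_ρ.mpr (by simp)
  refine ⟨by rw [mul_smul, mul_smul, inv_smul_smul, hST], ?_⟩
  rw [denom_mul_sl, denom_mul_sl, inv_smul_smul, hST]
  have hd : denom (↑(S * T) : GL (Fin 2) ℝ) ρ = (ρ : ℂ) + 1 := by
    rw [ModularGroup.denom_apply]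
    simp [ModularGroup.S, ModularGroup.T, Matrix.mul_apply, Fin.sum_univ_two]
  have h1 : denom (↑(k⁻¹ * k) : GL (Fin 2) ℝ) ρ = 1 := by
    rw [inv_mul_cancel]; simp [denom]
  rw [denom_mul_sl] at h1
  rw [hd, show ∀ a b c : ℂ, a * b * c = b * (c * a) from fun a b c ↦ by ring, h1, mul_one]

/-- `(ρ + 1)² = ρ` for `ρ = e^{2πi/3}` (`ρ² + ρ + 1 = 0`). [folklore] -/
theorem rho_add_one_sq : ((ρ : ℂ) + 1) ^ 2 = ρ := by
  have h3 : (ρ : ℂ) ^ 3 = 1 := PeriodPair.ρ_cube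
  have h1 : (ρ : ℂ) ≠ 1 := PeriodPair.ρ_ne_one
  have : (ρ : ℂ) ^ 2 + ρ + 1 = 0 := by
    have : ((ρ : ℂ) - 1) * ((ρ : ℂ) ^ 2 + ρ + 1) = 0 := by linear_combination h3
    rcases mul_eq_zero.mp this with h | h
    · exact absurd (sub_eq_zero.mp h) h1
    · exact h
  linear_combination this

/-- `ρ²` has multiplicative order `3`. [folklore] -/
theorem orderOf_rho_sq : orderOf ((ρ : ℂ) ^ 2) = 3 := by
  have h3 : (ρ : ℂ) ^ 3 = 1 := PeriodPair.ρ_cube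
  have h0 : (ρ : ℂ) ≠ 0 := PeriodPair.ρ_ne_zero
  refine orderOf_eq_prime ?_ fun h ↦ ?_
  · calc ((ρ : ℂ) ^ 2) ^ 3 = ((ρ : ℂ) ^ 3) ^ 2 := by ring
      _ = 1 := by rw [h3, one_pow]
  · apply PeriodPair.ρ_ne_one
    have : (ρ : ℂ) = (ρ : ℂ) ^ 3 * ((ρ : ℂ) ^ 2)⁻¹ := by field_simp
    rw [this, h3, h, inv_one, one_mul]

/-- The slash-invariance of a modular form for `Γ₀(N)` under `γ ∈ Γ₀(N)`. [folklore] -/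
theorem gamma0_slash_eq {k : ℤ} (F : ModularForm (Gamma0 N) k) {γ : SL(2, ℤ)} (hγ : γ ∈ Gamma0 N) :
    (F : ℍ → ℂ) ∣[k] γ = F :=
  SlashInvariantFormClass.slash_action_eq F _ ⟨γ, hγ, rfl⟩

/-- **`e_τ ∣ ord_τ(F) − ord_τ(G)`**: for nonzero modular forms `F, G` of the same weight for
`Γ₀(N)`, the orders of vanishing at `τ` are congruent modulo the period `e_τ = h_τ(Γ₀(N))`
(compare the multiplier identities `γ₀'(τ)^{ord F} = (cτ+d)^k = γ₀'(τ)^{ord G}` for a generator `γ₀`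
of the isotropy group, `γ₀'(τ)` a primitive `e_τ`-th root of unity: `−1` at points of period `2`,
`ρ²` at points of period `3`) (Diamond–Shurman §2.3, §3.2: `ν_π(f) ∈ (1/h)ℤ` for the order on `X(Γ)`).
[folklore] -/
theorem ellipticPeriod_dvd_orderAt_sub [NeZero N] {k : ℤ} {F G : ModularForm (Gamma0 N) k}
    (hF : F ≠ 0) (hG : G ≠ 0) (τ : ℍ) :
    (ellipticPeriod (Gamma0 N) τ : ℤ) ∣ (orderAt F τ : ℤ) - orderAt G τ := by
  have key : ∀ {γ : SL(2, ℤ)}, γ ∈ Gamma0 N → γ • τ = τ →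
      (denom γ τ ^ 2)⁻¹ ^ orderAt F τ = (denom γ τ ^ 2)⁻¹ ^ orderAt G τ := by
    intro γ hγ hγτ
    rw [deriv_smul_pow_orderAt_eq (holo F) (gamma0_slash_eq F hγ) hγτ (orderAt_eq hF τ).symm,
      deriv_smul_pow_orderAt_eq (holo G) (gamma0_slash_eq G hγ) hγτ (orderAt_eq hG τ).symm]
  rcases ellipticPeriod_trichotomy (Γ := Gamma0 N) τ with ⟨k', rfl⟩ | ⟨k', rfl⟩ | h1
  · -- `τ = k' i`
    rw [ellipticPeriod_smul_I]
    split_ifs with hmem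
    · rw [adjoinNegI_gamma0] at hmem
      obtain ⟨hfix, hden⟩ := conj_S_smul_and_denom k'
      have h := key hmem hfix
      rw [hden, Complex.I_sq, inv_neg, inv_one] at h
      -- `h : (-1)^a = (-1)^b`
      have hab : Even (orderAt F (k' • UpperHalfPlane.I) + orderAt G (k' • UpperHalfPlane.I)) := by
        refine (neg_one_pow_eq_one_iff_even (R := ℂ) (by norm_num)).mp ?_
        rw [pow_add, h, ← pow_add, ← two_mul, pow_mul]
        norm_num
      obtain ⟨c, hc⟩ := hab
      refine ⟨(c : ℤ) - orderAt G (k' • UpperHalfPlane.I), ?_⟩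
      push_cast
      omega
    · simp
  · -- `τ = k' ρ`
    rw [ellipticPeriod_smul_ρ]
    split_ifs with hmem
    · rw [adjoinNegI_gamma0] at hmem
      obtain ⟨hfix, hden⟩ := conj_ST_smul_and_denom k'
      have h := key hmem hfix
      rw [hden, rho_add_one_sq] at h
      have hρ : ((ρ : ℂ))⁻¹ = (ρ : ℂ) ^ 2 := by
        refine inv_eq_of_mul_eq_one_right ?_
        rw [← pow_succ']
        exact PeriodPair.ρ_cube
      rw [hρ] at h
      -- `h : (ρ²)^a = (ρ²)^b`, so `(ρ²)^(a + 2b) = (ρ²)^(3b) = 1` and `3 ∣ a + 2b`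
      set a := orderAt F (k' • ρ) with ha
      set b := orderAt G (k' • ρ) with hb
      have h1 : ((ρ : ℂ) ^ 2) ^ (a + 2 * b) = 1 := by
        rw [pow_add, h, ← pow_add, show b + 2 * b = 3 * b by ring, pow_mul,
          show ((ρ : ℂ) ^ 2) ^ 3 = ((ρ : ℂ) ^ 3) ^ 2 by ring, PeriodPair.ρ_cube]
        simp
      have hdvd := orderOf_dvd_of_pow_eq_one h1
      rw [orderOf_rho_sq] at hdvd
      obtain ⟨c, hc⟩ := hdvd
      refine ⟨(c : ℤ) - b, ?_⟩
      push_cast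
      omega
    · simp
  · rw [h1]; simp

end Isotropy2


/-! ### The order of a modular function at a point of `ℍ` -/

section OrdAt

variable {N : ℕ}

/-- `ord_τ(F + G) ≥ min` for nonzero forms with nonzero sum. [folklore] -/
theorem min_orderAt_le_orderAt_add {k : ℤ} {F G : ModularForm (Gamma0 N) k} (hF : F ≠ 0) (hG : G ≠ 0)
    (hFG : F + G ≠ 0) (τ : ℍ) : min (orderAt F τ) (orderAt G τ) ≤ orderAt (F + G) τ := by
  have h := le_analyticOrderAt_add (f := (F : ℍ → ℂ) ∘ ofComplex) (g := (G : ℍ → ℂ) ∘ ofComplex) (z₀ := τ)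
  rw [← orderAt_eq hF, ← orderAt_eq hG, show ((F : ℍ → ℂ) ∘ ofComplex) + ((G : ℍ → ℂ) ∘ ofComplex) =
    ((F + G : ModularForm (Gamma0 N) k) : ℍ → ℂ) ∘ ofComplex from rfl, ← orderAt_eq hFG] at h
  rcases le_total (orderAt F τ) (orderAt G τ) with hle | hle
  · rw [min_eq_left (by exact_mod_cast hle)] at h
    rw [min_eq_left hle]; exact_mod_cast h
  · rw [min_eq_right (by exact_mod_cast hle)] at h
    rw [min_eq_right hle]; exact_mod_cast h

/-- A representation of a nonzero modular function has nonzero numerator. [folklore] -/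
theorem num_ne_zero_of_repr {x : LaurentSeries ℂ} (hx : x ≠ 0) {k : ℤ} {F G : ModularForm (Gamma0 N) k}
    (h : x * qExpansionL N G = qExpansionL N F) (hG : G ≠ 0) : F ≠ 0 := by
  intro hF
  rw [hF, qExpansionL_zero, mul_eq_zero, qExpansionL_eq_zero_iff] at h
  exact h.elim hx hG

/-- **The order `ord_τ(x) ∈ ℤ` of a modular function `x ∈ K_N` at `τ ∈ ℍ`**: `ord_τ(F) − ord_τ(G)`
for a representation `x = F/G` (well defined, `ordAt_eq_of_repr`; junk for `x = 0`)
(Diamond–Shurman §3.2; Shimura §2.4). [folklore] -/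
def ordAt (τ : ℍ) (x : modularFunctionField N) : ℤ :=
  open Classical in
  if x = 0 then 0 else
    (orderAt x.2.choose_spec.choose τ : ℤ) - orderAt x.2.choose_spec.choose_spec.choose τ

/-- `ord_τ(0) = 0` (junk value). [folklore] -/
@[simp] theorem ordAt_zero (τ : ℍ) : ordAt τ (0 : modularFunctionField N) = 0 := by
  simp [ordAt]

/-- **`ordAt` is independent of the representation**: if `x = F/G ≠ 0` then
`ord_τ(x) = ord_τ(F) − ord_τ(G)`. [folklore] -/
theorem ordAt_eq_of_repr {τ : ℍ} {x : modularFunctionField N} (hx : x ≠ 0) {k : ℤ}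
    {F G : ModularForm (Gamma0 N) k} (hG : G ≠ 0)
    (h : (x : LaurentSeries ℂ) * qExpansionL N G = qExpansionL N F) :
    ordAt τ x = (orderAt F τ : ℤ) - orderAt G τ := by
  have hx' : (x : LaurentSeries ℂ) ≠ 0 := fun h0 ↦ hx (Subtype.ext h0)
  rw [ordAt, if_neg hx]
  obtain ⟨hG₀, h₀⟩ := x.2.choose_spec.choose_spec.choose_spec
  have hF₀0 := num_ne_zero_of_repr hx' h₀ hG₀
  have hF0 : F ≠ 0 := num_ne_zero_of_repr hx' h hG
  have hmul := mul_eq_mul_of_repr h₀ h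
  have key : orderAt (x.2.choose_spec.choose.mul G) τ =
      orderAt (x.2.choose_spec.choose_spec.choose.mul F) τ := congrArg (orderAt · τ) hmul
  rw [orderAt_mul hF₀0 hG, orderAt_mul hG₀ hF0] at key
  omega

/-- The class of `F/G` in `K_N`. [folklore] -/
def mkFn {k : ℤ} (F G : ModularForm (Gamma0 N) k) (hG : G ≠ 0) : modularFunctionField N :=
  ⟨qExpansionL N F / qExpansionL N G, div_mem_modularFunctionField N F G hG⟩

/-- The defining relation of `mkFn F G`. [folklore] -/
theorem mkFn_mul {k : ℤ} (F G : ModularForm (Gamma0 N) k) (hG : G ≠ 0) :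
    ((mkFn F G hG : modularFunctionField N) : LaurentSeries ℂ) * qExpansionL N G = qExpansionL N F :=
  div_mul_cancel₀ _ ((qExpansionL_eq_zero_iff N G).not.mpr hG)

/-- `mkFn F G ≠ 0` iff `F ≠ 0`. [folklore] -/
theorem mkFn_ne_zero {k : ℤ} {F G : ModularForm (Gamma0 N) k} (hG : G ≠ 0) (hF : F ≠ 0) :
    mkFn F G hG ≠ 0 := by
  intro h
  have := congrArg (fun y : modularFunctionField N ↦ (y : LaurentSeries ℂ)) h
  simp only [mkFn, ZeroMemClass.coe_zero, div_eq_zero_iff, qExpansionL_eq_zero_iff] at this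
  exact this.elim hF hG

/-- `ord_τ(F/G) = ord_τ F − ord_τ G`. [folklore] -/
theorem ordAt_mkFn {τ : ℍ} {k : ℤ} {F G : ModularForm (Gamma0 N) k} (hG : G ≠ 0) (hF : F ≠ 0) :
    ordAt τ (mkFn F G hG) = (orderAt F τ : ℤ) - orderAt G τ :=
  ordAt_eq_of_repr (mkFn_ne_zero hG hF) hG (mkFn_mul F G hG)

/-- **`ord_τ(xy) = ord_τ(x) + ord_τ(y)`** for `x, y ≠ 0`. [folklore] -/
theorem ordAt_mul (τ : ℍ) {x y : modularFunctionField N} (hx : x ≠ 0) (hy : y ≠ 0) :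
    ordAt τ (x * y) = ordAt τ x + ordAt τ y := by
  obtain ⟨k, F, G, hG, h⟩ := x.2
  obtain ⟨k', F', G', hG', h'⟩ := y.2
  have hx' : (x : LaurentSeries ℂ) ≠ 0 := fun h0 ↦ hx (Subtype.ext h0)
  have hy' : (y : LaurentSeries ℂ) ≠ 0 := fun h0 ↦ hy (Subtype.ext h0)
  have hF := num_ne_zero_of_repr hx' h hG
  have hF' := num_ne_zero_of_repr hy' h' hG'
  have hGG' : G.mul G' ≠ 0 := by
    rw [Ne, ← qExpansionL_eq_zero_iff, qExpansionL_mul, mul_eq_zero, qExpansionL_eq_zero_iff,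
      qExpansionL_eq_zero_iff, not_or]; exact ⟨hG, hG'⟩
  have hxy : ((x * y : modularFunctionField N) : LaurentSeries ℂ) * qExpansionL N (G.mul G') =
      qExpansionL N (F.mul F') := by
    rw [MulMemClass.coe_mul, qExpansionL_mul, qExpansionL_mul, ← h, ← h']; ring
  rw [ordAt_eq_of_repr (mul_ne_zero hx hy) hGG' hxy, ordAt_eq_of_repr hx hG h,
    ordAt_eq_of_repr hy hG' h', orderAt_mul hF hF', orderAt_mul hG hG']
  push_cast; ring

/-- **`ord_τ(x + y) ≥ min(ord_τ x, ord_τ y)`** for `x, y, x + y ≠ 0`. [folklore] -/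
theorem min_ordAt_le_ordAt_add (τ : ℍ) {x y : modularFunctionField N} (hx : x ≠ 0) (hy : y ≠ 0)
    (hxy : x + y ≠ 0) : min (ordAt τ x) (ordAt τ y) ≤ ordAt τ (x + y) := by
  obtain ⟨k, F, G, hG, h⟩ := x.2
  obtain ⟨k', F', G', hG', h'⟩ := y.2
  have hx' : (x : LaurentSeries ℂ) ≠ 0 := fun h0 ↦ hx (Subtype.ext h0)
  have hy' : (y : LaurentSeries ℂ) ≠ 0 := fun h0 ↦ hy (Subtype.ext h0)
  have hxy' : ((x + y : modularFunctionField N) : LaurentSeries ℂ) ≠ 0 := fun h0 ↦ hxy (Subtype.ext h0)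
  have hF := num_ne_zero_of_repr hx' h hG
  have hF' := num_ne_zero_of_repr hy' h' hG'
  have hGG' : G.mul G' ≠ 0 := by
    rw [Ne, ← qExpansionL_eq_zero_iff, qExpansionL_mul, mul_eq_zero, qExpansionL_eq_zero_iff,
      qExpansionL_eq_zero_iff, not_or]; exact ⟨hG, hG'⟩
  have hrepr : ((x + y : modularFunctionField N) : LaurentSeries ℂ) * qExpansionL N (G.mul G') =
      qExpansionL N (F.mul G' + G.mul F') := by
    rw [AddMemClass.coe_add, qExpansionL_add, qExpansionL_mul, qExpansionL_mul, qExpansionL_mul, ← h, ← h']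
    ring
  have hnum : F.mul G' + G.mul F' ≠ 0 := num_ne_zero_of_repr hxy' hrepr hGG'
  have h1 : F.mul G' ≠ 0 := by
    rw [Ne, ← qExpansionL_eq_zero_iff, qExpansionL_mul, mul_eq_zero, qExpansionL_eq_zero_iff,
      qExpansionL_eq_zero_iff, not_or]; exact ⟨hF, hG'⟩
  have h2 : G.mul F' ≠ 0 := by
    rw [Ne, ← qExpansionL_eq_zero_iff, qExpansionL_mul, mul_eq_zero, qExpansionL_eq_zero_iff,
      qExpansionL_eq_zero_iff, not_or]; exact ⟨hG, hF'⟩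
  have hmin := min_orderAt_le_orderAt_add h1 h2 hnum τ
  rw [orderAt_mul hF hG', orderAt_mul hG hF'] at hmin
  rw [ordAt_eq_of_repr hxy hGG' hrepr, ordAt_eq_of_repr hx hG h, ordAt_eq_of_repr hy hG' h',
    orderAt_mul hG hG']
  push_cast
  omega

/-- Nonzero constants have order `0`. [folklore] -/
theorem ordAt_algebraMap (τ : ℍ) {c : ℂ} (hc : c ≠ 0) :
    ordAt τ (algebraMap ℂ (modularFunctionField N) c) = 0 := by
  have h1 : (1 : ModularForm (Gamma0 N) 0) ≠ 0 := one_ne_zero_modularForm N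
  have hc1 : (c • (1 : ModularForm (Gamma0 N) 0)) ≠ 0 := by
    intro h
    have := congrArg (fun f : ModularForm (Gamma0 N) 0 ↦ f UpperHalfPlane.I) h
    simp [hc] at this
  have hrepr : ((algebraMap ℂ (modularFunctionField N) c : modularFunctionField N) : LaurentSeries ℂ) *
      qExpansionL N (1 : ModularForm (Gamma0 N) 0) = qExpansionL N (c • (1 : ModularForm (Gamma0 N) 0)) := by
    rw [qExpansionL_smul, qExpansionL_one, mul_one, ← HahnSeries.C_mul_eq_smul, mul_one,
      show ((algebraMap ℂ (modularFunctionField N) c : modularFunctionField N) : LaurentSeries ℂ) =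
        algebraMap ℂ (LaurentSeries ℂ) c from rfl, algebraMap_laurentSeries_apply]
  have hne : (algebraMap ℂ (modularFunctionField N) c) ≠ 0 := by
    rw [Ne, map_eq_zero]; exact hc
  rw [ordAt_eq_of_repr hne h1 hrepr]
  -- both orders vanish: the forms are nonvanishing constants
  have h0 : ∀ {F : ModularForm (Gamma0 N) 0}, F UpperHalfPlane.I ≠ 0 → (∀ z w : ℍ, F z = F w) → orderAt F τ = 0 := by
    intro F hFI hconst
    rw [orderAt]
    have : analyticOrderAt ((F : ℍ → ℂ) ∘ ofComplex) τ = 0 := by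
      refine (analyticAt_comp_ofComplex (holo F) τ).analyticOrderAt_eq_zero.mpr ?_
      rw [Function.comp_apply, ofComplex_apply, hconst τ UpperHalfPlane.I]; exact hFI
    rw [this]; rfl
  rw [h0 (by simp [hc]) (fun z w ↦ by simp), h0 (by simp) (fun z w ↦ by simp)]
  simp

/-- **`e_τ ∣ ord_τ(x)`** for every modular function `x` (period `e_τ` of `τ` for `Γ₀(N)`). [folklore] -/
theorem ellipticPeriod_dvd_ordAt [NeZero N] (τ : ℍ) (x : modularFunctionField N) :
    (ellipticPeriod (Gamma0 N) τ : ℤ) ∣ ordAt τ x := by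
  by_cases hx : x = 0
  · rw [hx, ordAt_zero]; exact dvd_zero _
  obtain ⟨k, F, G, hG, h⟩ := x.2
  have hx' : (x : LaurentSeries ℂ) ≠ 0 := fun h0 ↦ hx (Subtype.ext h0)
  rw [ordAt_eq_of_repr hx hG h]
  exact ellipticPeriod_dvd_orderAt_sub (num_ne_zero_of_repr hx' h hG) hG τ

end OrdAt


/-! ### The place of `K_N` at a point of `ℍ` -/

section PointPlace

variable {N : ℕ} [NeZero N]

/-- The **normalised order** `ν_τ(x) = ord_τ(x)/e_τ ∈ ℤ` of a modular function at `τ` (the order on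
the quotient `X₀(N)`, where `e_τ` sheets come together; Diamond–Shurman §3.2 `ν_{π(τ)}(f) = ord_τ(f)/h`).
[folklore] -/
def ordAtN (τ : ℍ) (x : modularFunctionField N) : ℤ :=
  ordAt τ x / ellipticPeriod (Gamma0 N) τ

omit [NeZero N] in
/-- `e_τ > 0` as an integer. [folklore] -/
theorem ellipticPeriod_cast_pos (τ : ℍ) : (0 : ℤ) < ellipticPeriod (Gamma0 N) τ := by
  exact_mod_cast ellipticPeriod_pos (Gamma0 N) τ

/-- `ν_τ(x) · e_τ = ord_τ(x)` (the division is exact). [folklore] -/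
theorem ordAtN_mul_ellipticPeriod (τ : ℍ) (x : modularFunctionField N) :
    ordAtN τ x * ellipticPeriod (Gamma0 N) τ = ordAt τ x :=
  Int.ediv_mul_cancel (ellipticPeriod_dvd_ordAt τ x)

omit [NeZero N] in
/-- `ν_τ(0) = 0`. [folklore] -/
@[simp] theorem ordAtN_zero (τ : ℍ) : ordAtN τ (0 : modularFunctionField N) = 0 := by
  simp [ordAtN]

/-- `ν_τ(xy) = ν_τ(x) + ν_τ(y)`. [folklore] -/
theorem ordAtN_mul (τ : ℍ) {x y : modularFunctionField N} (hx : x ≠ 0) (hy : y ≠ 0) :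
    ordAtN τ (x * y) = ordAtN τ x + ordAtN τ y := by
  rw [ordAtN, ordAt_mul τ hx hy, Int.add_ediv_of_dvd_left (ellipticPeriod_dvd_ordAt τ x)]
  rfl

omit [NeZero N] in
/-- `ν_τ(x + y) ≥ min(ν_τ x, ν_τ y)`. [folklore] -/
theorem min_ordAtN_le_ordAtN_add (τ : ℍ) {x y : modularFunctionField N} (hx : x ≠ 0) (hy : y ≠ 0)
    (hxy : x + y ≠ 0) : min (ordAtN τ x) (ordAtN τ y) ≤ ordAtN τ (x + y) := by
  have hmono : Monotone fun a : ℤ ↦ a / (ellipticPeriod (Gamma0 N) τ : ℤ) :=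
    fun a b h ↦ Int.ediv_le_ediv (ellipticPeriod_cast_pos τ) h
  change min ((fun a : ℤ ↦ a / (ellipticPeriod (Gamma0 N) τ : ℤ)) (ordAt τ x))
      ((fun a : ℤ ↦ a / (ellipticPeriod (Gamma0 N) τ : ℤ)) (ordAt τ y)) ≤
    (fun a : ℤ ↦ a / (ellipticPeriod (Gamma0 N) τ : ℤ)) (ordAt τ (x + y))
  rw [← hmono.map_min]
  exact hmono (min_ordAt_le_ordAt_add τ hx hy hxy)

omit [NeZero N] in
/-- `ν_τ(c) = 0` for a nonzero constant. [folklore] -/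
theorem ordAtN_algebraMap (τ : ℍ) {c : ℂ} (hc : c ≠ 0) :
    ordAtN τ (algebraMap ℂ (modularFunctionField N) c) = 0 := by
  simp [ordAtN, ordAt_algebraMap τ hc]

/-- **The valuation of `K_N` at `τ ∈ ℍ`**: `v_τ(x) = exp(−ν_τ(x)) ∈ ℤᵐ⁰` (multiplicative form of
the normalised order of vanishing at the point `Γ₀(N)τ ∈ X₀(N)`; Stichtenoth §1.1, Diamond–Shurman
§3.2). [folklore] -/
def pointValuation (τ : ℍ) : Valuation (modularFunctionField N) ℤᵐ⁰ where
  toFun x := open Classical in if x = 0 then 0 else WithZero.exp (-ordAtN τ x)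
  map_zero' := by simp
  map_one' := by
    simp only [one_ne_zero, if_false]
    rw [show (1 : modularFunctionField N) = algebraMap ℂ (modularFunctionField N) 1 from (map_one _).symm,
      ordAtN_algebraMap τ one_ne_zero]
    simp
  map_mul' x y := by
    classical
    by_cases hx : x = 0
    · simp [hx]
    by_cases hy : y = 0
    · simp [hy]
    simp only [mul_ne_zero hx hy, hx, hy, if_false, ordAtN_mul τ hx hy, neg_add, WithZero.exp_add]
  map_add_le_max' x y := by
    classical
    by_cases hxy : x + y = 0
    · simp [hxy]
    by_cases hx : x = 0
    · simp [hx]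
    by_cases hy : y = 0
    · simp [hy]
    simp only [hxy, hx, hy, if_false, le_max_iff, WithZero.exp_le_exp, neg_le_neg_iff]
    have := min_ordAtN_le_ordAtN_add τ hx hy hxy
    rcases min_le_iff.mp this with h | h
    · exact Or.inl h
    · exact Or.inr h

/-- `v_τ(x) = exp(−ν_τ(x))` for `x ≠ 0`. [folklore] -/
theorem pointValuation_apply (τ : ℍ) {x : modularFunctionField N} (hx : x ≠ 0) :
    pointValuation τ x = WithZero.exp (-ordAtN τ x) := by
  classical
  exact if_neg hx

/-- `v_τ(x) ≤ WithZero.exp n ↔ −n ≤ ν_τ(x)` for `x ≠ 0`. [folklore] -/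
theorem pointValuation_le_exp_iff (τ : ℍ) {x : modularFunctionField N} (hx : x ≠ 0) (n : ℤ) :
    pointValuation τ x ≤ WithZero.exp n ↔ -n ≤ ordAtN τ x := by
  rw [pointValuation_apply τ hx, WithZero.exp_le_exp, neg_le]

/-- `x ∈ O_τ ↔ x = 0 ∨ 0 ≤ ν_τ(x)`. [folklore] -/
theorem mem_valuationSubring_pointValuation_iff (τ : ℍ) (x : modularFunctionField N) :
    x ∈ (pointValuation τ).valuationSubring ↔ x = 0 ∨ 0 ≤ ordAtN τ x := by
  rw [Valuation.mem_valuationSubring_iff]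
  by_cases hx : x = 0
  · simp [hx]
  · rw [← WithZero.exp_zero, pointValuation_le_exp_iff τ hx, neg_zero]
    simp [hx]

/-- `Δ|_{Γ₀(N)}` as used for uniformizers. [folklore] -/
abbrev deltaN (N : ℕ) : ModularForm (Gamma0 N) 12 := ofLevelOne (Gamma0 N) delta

/-- The function `(E₄³ − j(τ₀)Δ)/Δ = j − j(τ₀) ∈ K_N`. [folklore] -/
def kleinJSub (N : ℕ) (τ₀ : ℍ) : modularFunctionField N :=
  mkFn (E₄cubeSubSmulDelta N (kleinJ τ₀)) (deltaN N) ofLevelOne_delta_ne_zero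

omit [NeZero N] in
/-- `ord_{τ₀}(j − j(τ₀)) = 3, 2, 1` (`E₄(τ₀) = 0`, `E₆(τ₀) = 0`, otherwise). [folklore] -/
theorem ordAt_kleinJSub (τ₀ : ℍ) :
    ordAt τ₀ (kleinJSub N τ₀) = if E₄ τ₀ = 0 then 3 else if E₆ τ₀ = 0 then 2 else 1 := by
  rw [kleinJSub, ordAt_mkFn ofLevelOne_delta_ne_zero (E₄cubeSubSmulDelta_ne_zero τ₀),
    orderAt_E₄cubeSubSmulDelta_kleinJ, orderAt_delta]
  split_ifs <;> simp

omit [NeZero N] in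
/-- `j − j(τ₀) ≠ 0` in `K_N`. [folklore] -/
theorem kleinJSub_ne_zero (τ₀ : ℍ) : kleinJSub N τ₀ ≠ 0 :=
  mkFn_ne_zero _ (E₄cubeSubSmulDelta_ne_zero τ₀)

omit [NeZero N] in
/-- `0 < ord_{τ₀}(j − j(τ₀))`. [folklore] -/
theorem ordAt_kleinJSub_pos (τ₀ : ℍ) : 0 < ordAt τ₀ (kleinJSub N τ₀) := by
  rw [ordAt_kleinJSub]; split_ifs <;> norm_num

/-- `0 < ν_{τ₀}(j − j(τ₀))`. [folklore] -/
theorem ordAtN_kleinJSub_pos (τ₀ : ℍ) : 0 < ordAtN τ₀ (kleinJSub N τ₀) := by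
  have h := ordAtN_mul_ellipticPeriod τ₀ (kleinJSub N τ₀)
  have hpos := ordAt_kleinJSub_pos (N := N) τ₀
  have he := ellipticPeriod_cast_pos (N := N) τ₀
  by_contra hle
  push Not at hle
  nlinarith

/-- The value group of `v_τ` is nontrivial (`v_τ(j − j(τ)) < 1`). [folklore] -/
theorem nontrivial_valueGroup_pointValuation (τ : ℍ) :
    Nontrivial (MonoidWithZeroHom.valueGroup (.ofClass (pointValuation (N := N) τ))) := by
  rw [Subgroup.nontrivial_iff_exists_ne_one]
  have hv : pointValuation τ (kleinJSub N τ) = WithZero.exp (-ordAtN τ (kleinJSub N τ)) :=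
    pointValuation_apply τ (kleinJSub_ne_zero τ)
  refine ⟨Units.mk0 (pointValuation τ (kleinJSub N τ)) (by rw [hv]; exact WithZero.exp_ne_zero), ?_, ?_⟩
  · exact MonoidWithZeroHom.mem_valueGroup _ ⟨kleinJSub N τ, rfl⟩
  · intro h
    have := congrArg Units.val h
    simp only [Units.val_mk0, Units.val_one, hv] at this
    rw [← WithZero.exp_zero, WithZero.exp_injective.eq_iff, neg_eq_zero] at this
    exact (ordAtN_kleinJSub_pos (N := N) τ).ne' this

/-- **The place `P_τ` of `K_N/ℂ` at the point `Γ₀(N)τ` of `Y₀(N)`**: the valuation ring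
`O_τ = {x ∈ K_N : ord_τ(x) ≥ 0}` of modular functions holomorphic at `τ`, a discrete valuation ring
containing `ℂ` and different from `K_N` (`1/(j − j(τ)) ∉ O_τ`) (Shimura §2.4; Diamond–Shurman §3.2,
§7.5). [folklore] -/
def pointPlace (τ : ℍ) : DiophantineGeometry.AlgFunctionField.PlaceOver ℂ (modularFunctionField N) :=
  haveI := nontrivial_valueGroup_pointValuation (N := N) τ
  { toValuationSubring := (pointValuation τ).valuationSubring
    ne_top := by
      intro h
      have hmem : (kleinJSub N τ)⁻¹ ∈ (pointValuation (N := N) τ).valuationSubring := by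
        rw [h]; trivial
      rw [mem_valuationSubring_pointValuation_iff] at hmem
      rcases hmem with h0 | h0
      · exact (inv_ne_zero (kleinJSub_ne_zero τ)) h0
      · have h1 : ordAtN τ ((kleinJSub N τ)⁻¹ * kleinJSub N τ) = 0 := by
          rw [inv_mul_cancel₀ (kleinJSub_ne_zero τ),
            show (1 : modularFunctionField N) = algebraMap ℂ (modularFunctionField N) 1 from (map_one _).symm,
            ordAtN_algebraMap τ one_ne_zero]
        rw [ordAtN_mul τ (inv_ne_zero (kleinJSub_ne_zero τ)) (kleinJSub_ne_zero τ)] at h1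
        have := ordAtN_kleinJSub_pos (N := N) τ
        omega
    isDVR := inferInstance
    algebraMap_mem := fun c ↦ by
      rw [mem_valuationSubring_pointValuation_iff]
      by_cases hc : c = 0
      · left; rw [hc, map_zero]
      · right; rw [ordAtN_algebraMap τ hc] }

/-- The valuation ring of `P_τ` is that of `v_τ`. [folklore] -/
@[simp] theorem pointPlace_toValuationSubring (τ : ℍ) :
    (pointPlace (N := N) τ).toValuationSubring = (pointValuation τ).valuationSubring := rfl

/-- The valuation of the place `P_τ` is equivalent to `v_τ`. [folklore] -/
theorem isEquiv_pointValuation (τ : ℍ) :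
    (pointValuation (N := N) τ).IsEquiv (pointPlace (N := N) τ).valuation := by
  rw [Valuation.isEquiv_iff_valuationSubring, DiophantineGeometry.AlgFunctionField.PlaceOver.valuation,
    ValuationSubring.valuationSubring_valuation, pointPlace_toValuationSubring]

/-- If the ramification index of `j` at `τ` equals the period `e_τ` (i.e. `τ` is elliptic or
`E₄(τ)E₆(τ) ≠ 0`), then `j − j(τ)` is a **uniformizer**: `v_τ(j − j(τ)) = exp(−1)`. [folklore] -/
theorem pointValuation_kleinJSub_of_eq (τ : ℍ)
    (h : (if E₄ τ = 0 then 3 else if E₆ τ = 0 then 2 else 1) = ellipticPeriod (Gamma0 N) τ) :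
    pointValuation τ (kleinJSub N τ) = WithZero.exp (-1) := by
  rw [pointValuation_apply τ (kleinJSub_ne_zero τ)]
  congr 2
  have h1 := ordAtN_mul_ellipticPeriod τ (kleinJSub N τ)
  rw [ordAt_kleinJSub] at h1
  split_ifs at h h1 <;> · rw [← h] at h1; push_cast at h1; omega

end PointPlace


/-! ### `Γ₀(N)`-invariance: the place only depends on the point of `Y₀(N)` -/

section Invariance

variable {N : ℕ}

/-- `ord_{γτ}(F) = ord_τ(F)` for `γ ∈ Γ₀(N)`. [folklore] -/
theorem orderAt_smul_of_mem {k : ℤ} (F : ModularForm (Gamma0 N) k) {γ : SL(2, ℤ)} (hγ : γ ∈ Gamma0 N)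
    (τ : ℍ) : orderAt F (γ • τ) = orderAt F τ := by
  unfold orderAt
  rw [← analyticOrderAt_SL_slash (holo F) γ τ, gamma0_slash_eq F hγ]

/-- `ord_{γτ}(x) = ord_τ(x)` for `γ ∈ Γ₀(N)` and `x ∈ K_N`. [folklore] -/
theorem ordAt_smul_of_mem {γ : SL(2, ℤ)} (hγ : γ ∈ Gamma0 N) (τ : ℍ) (x : modularFunctionField N) :
    ordAt (γ • τ) x = ordAt τ x := by
  by_cases hx : x = 0
  · simp [hx]
  obtain ⟨k, F, G, hG, h⟩ := x.2
  rw [ordAt_eq_of_repr hx hG h, ordAt_eq_of_repr hx hG h, orderAt_smul_of_mem F hγ,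
    orderAt_smul_of_mem G hγ]

/-- `ν_{γτ}(x) = ν_τ(x)` for `γ ∈ Γ₀(N)`. [folklore] -/
theorem ordAtN_smul_of_mem {γ : SL(2, ℤ)} (hγ : γ ∈ Gamma0 N) (τ : ℍ) (x : modularFunctionField N) :
    ordAtN (γ • τ) x = ordAtN τ x := by
  rw [ordAtN, ordAtN, ordAt_smul_of_mem hγ,
    ellipticPeriod_smul_of_mem (Gamma0 N) (by rw [adjoinNegI_gamma0]; exact hγ)]

variable [NeZero N]

/-- `v_{γτ} = v_τ` for `γ ∈ Γ₀(N)`. [folklore] -/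
theorem pointValuation_smul_of_mem {γ : SL(2, ℤ)} (hγ : γ ∈ Gamma0 N) (τ : ℍ) :
    pointValuation (N := N) (γ • τ) = pointValuation τ := by
  ext x
  by_cases hx : x = 0
  · simp [hx]
  · rw [pointValuation_apply _ hx, pointValuation_apply _ hx, ordAtN_smul_of_mem hγ]

/-- **`P_{γτ} = P_τ` for `γ ∈ Γ₀(N)`**: the place only depends on the orbit `Γ₀(N)τ ∈ Y₀(N)`.
[folklore] -/
theorem pointPlace_smul_of_mem {γ : SL(2, ℤ)} (hγ : γ ∈ Gamma0 N) (τ : ℍ) :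
    pointPlace (N := N) (γ • τ) = pointPlace τ := by
  apply DiophantineGeometry.AlgFunctionField.PlaceOver.ext
  rw [pointPlace_toValuationSubring, pointPlace_toValuationSubring, pointValuation_smul_of_mem hγ]

/-- **Reading `ord` at `P_τ` when `j − j(τ)` is a uniformizer**: if the ramification index of `j`
at `τ` equals `e_τ`, then for `x ≠ 0` the defining condition `v_P(x) ≤ v_P(π_P)^{-n}` of the
Riemann–Roch space at `P_τ` reads `−n ≤ ν_τ(x)` (`valuation_le_iff_of_isEquiv` of
`FunctionFieldDivisorsResidueMap`). [folklore] -/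
theorem pointPlace_valuation_le_iff_of_eq (τ : ℍ)
    (h : (if E₄ τ = 0 then 3 else if E₆ τ = 0 then 2 else 1) = ellipticPeriod (Gamma0 N) τ)
    {x : modularFunctionField N} (hx : x ≠ 0) (n : ℤ) :
    (pointPlace (N := N) τ).valuation x ≤
        (pointPlace (N := N) τ).valuation ((pointPlace (N := N) τ).uniformizer : modularFunctionField N) ^ (-n) ↔
      -n ≤ ordAtN τ x := by
  rw [DiophantineGeometry.AlgFunctionField.PlaceOver.valuation_le_iff_of_isEquiv (pointPlace τ) (isEquiv_pointValuation τ)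
    ⟨kleinJSub N τ, pointValuation_kleinJSub_of_eq τ h⟩, pointValuation_le_exp_iff τ hx]

end Invariance

end Literature.NumberTheory.EllipticCurves.ModularForms

end
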